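import Literature.MathematicalPhysics.QuantumFieldTheory.Balaban1983to89.B9Thm312WholeDirBC

/-!
# `Balaban1983to89.B9Thm312WholeDirBCDs` — [B9] Theorem 3.12∕3.13 (pp. 421–426): the β∕ε-indexed STEP SCHEMA `StepDirB` of rows 20–21 (class-localised
# input norm, repair «R2-loc») WITH ITS (3.44)-TYPE HYPOTHESIS WEAKENED TO THE ONE FIELD THE ENGINE READS — `Thm33G0DivR.h44Ds` (D\*_U G₀ ∇\*_{U,μ}) in
# place of the whole record `Thm33G0DivR` (whose second field `h44DsDv`, D\*_U G₀ D_U, no step member uses)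

T. Bałaban, *Propagators for lattice gauge theories in a background field*, Commun. Math. Phys. **99** (1985) 389–434
[`Balaban1985BackgroundPropagators`, "B9"]; [4] = T. Bałaban, *Propagators and renormalization transformations for lattice
gauge theories. II*, Commun. Math. Phys. **96** (1984) 223–250 [`Balaban1984PropagatorsII`].  statement-level skeleton of published
theorems with citation tags; proofs where landed; nothing here is a claim about the Yang–Mills mass gap.

THE LOCATED POINT (dag-n06-d g12, cell bus 2026-08-28 «LOCATED-ED36-d»).  The N06 stage-11 certificate (edition 35, `…N06AtOpsYNuOfRecordV6EPairNP`,
binder `hdiv`) displays BOTH (3.44)-type members of Theorem 3.3 for `G₀ = G(U)` with the divergence on the left, as the record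
`B9Thm312WholeRightStepFrom3131.Thm33G0DivR 𝔬 Dds R₀ H₀ _ bHX bHW BiD BdD δ₀ δ₃ U` — field `h44Ds μ ε` (D\*_U G₀ ∇\*_{U,μ} out of the bond input class
`bHX ε`, rate δ₀) and field `h44DsDv ε` (D\*_U G₀ D_U out of the scalar input class `bHW ε`, rate δ₃).  Its only consumer, the step engine
`B9Thm312WholeDirBC.stepDirB_of_letters3131LRCZ` (dag-n06-l), reads the record in ONE place, `B9Thm312WholeRightStepFrom3131C.tDd_of_letters3131RC`, and
that proof reads `hdiv.h44Ds μ ε hε` ONLY (p. 421's placement rule puts the perturbation Δ′_π to the LEFT of G₀∇\*_{U,μ}; the reader of the second field,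
`B9Thm312WholeRightStepFrom3131.tDv_of_letters3131R`, has no caller).  The second field is therefore idle for `StepDirB`; at node00-def-Y's pins it is
the one place where a transport letter on `U` («small-gauge position», dag-n06-l `B9GradViaDivLettersAtPinsHolderEps.h44DsDv_eps_pins`, binder `hΘ`)
and the rate inequality `δ₃ ≤ δ₀` would enter (dag-n06-w5 `B9Thm33G0DivRWholeAtPins`, ANSWER-LOCATED-ED36 (b)).  THIS FILE weakens the engine's
hypothesis to the field it reads, so that the certificate's `hdiv` becomes a theorem of the pins (dag-n06-w5 `B9Thm33G0DivRAtPins.h44Ds_pins`: no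
transport letter, no `δ₃ ≤ δ₀`) with NO new displayed hypothesis:
* ★ `tDd_of_letters3131RC_ofDs` — `tDd_of_letters3131RC` with `hdiv` ↦ `hdivDs` (proof verbatim, `hdiv.h44Ds μ ε hε` ↦ `hdivDs μ ε hε`);
* ★★ `stepDirB_of_letters3131LRCZ_ofDs` — `stepDirB_of_letters3131LRCZ` with `hdiv` ↦ `hdivDs` (proof verbatim; conclusion `StepDirB …` byte-identical);
(The original engine is the corollary `stepDirB_of_letters3131LRCZ_ofDs … (fun μ ε hε => hdiv.h44Ds μ ε hε) …` — nothing is lost; dag-n06-l may fold at leisure.)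
HONEST SCOPE.  Bookkeeping: a hypothesis of a landed schema lemma weakened to the conjunct its proof uses; the proofs are dag-n06-l's, copied with credit
([4] (2.52)–(2.54), Lemma 2.1 inside); Theorem 3.3's entries, the Hölder ∕ mixed letters and the (3.131)∕(3.137) letters remain hypotheses; count-neutral;
N06 NOT discharged; one finite lattice at a time — nothing continuum ∕ ℝ⁴ ∕ OS ∕ mass gap ∕ Clay.  Cell `pub-ymgap` (HUMAN RULING D-0062), node N06 [B9],
rows 20–21, knit seat `pub-ymgap-dag-n06-d` (g12), 2026-08-28.  NEW file; nothing landed is modified; 0 `def`.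
-/

namespace Literature.MathematicalPhysics.QuantumFieldTheory.Balaban1983to89.B9Thm312WholeDirBCDs

open Finset B6RandomWalk B6RandomWalkHom B9Thm34Ext B11SectG B9SectDSup B9Thm312Whole B9Thm312WholeLeaf B9Thm312WholeClasses
open B9RWSums343Holder B9RWSums343to347Whole B9RWSums346Schur B9Thm312WholeDir B9Thm313WholeHolder B9Thm313WholeDir
open B9Thm312WholeStepFrom3131 B9Thm312WholeLeftStepFrom3131 B9Thm312WholeStepDirFrom3131 B9Thm312WholeRightStepFrom3131
open B9Thm312WholeDirB B9Thm313WholeZ B9Thm313WholeLeftZ B9Thm313WholeHolderZ B9Thm313WholeDirZ B9Thm312WholeDirBZ B9Thm312WholeRightStepFrom3131C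
open B9BlockNormClassTransfer (hasMaj_of_dom_classes_eq)

noncomputable section

section OneMember

variable {g : B9.Geometry} {B : B9.Backgrounds} {X Y Z W PX PY P : Type}
variable [Fintype X] [Fintype Y] [Fintype Z] [Fintype W] [Fintype PX] [Fintype PY] [Fintype P] [Fintype g.Site]
variable {R₀ : ℝ} {H₀ : Prop}

omit [Fintype Y] [Fintype Z] [Fintype W] [Fintype PX] [Fintype PY] [Fintype P] [Fintype X] [Fintype g.Site] in
/-- Kernel monotonicity: C·e^{−rd} ≦ θ·e^{−δ_K d} for 0 ≦ C ≦ θ, δ_K ≦ r, d ≧ 0. [folklore] -/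
private theorem kernel_le_z {C θ r δK d : ℝ} (hC : 0 ≤ C) (hCθ : C ≤ θ) (hδK : δK ≤ r) (hd : 0 ≤ d) :
    C * Real.exp (-(r * d)) ≤ θ * Real.exp (-(δK * d)) :=
  calc C * Real.exp (-(r * d)) ≤ C * Real.exp (-(δK * d)) :=
      mul_le_mul_of_nonneg_left (Real.exp_le_exp.mpr (neg_le_neg (mul_le_mul_of_nonneg_right hδK hd))) hC
    _ ≤ θ * Real.exp (-(δK * d)) := mul_le_mul_of_nonneg_right hCθ (Real.exp_nonneg _)

omit [Fintype Y] [Fintype Z] [Fintype PX] [Fintype PY] [Fintype P] in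
/-- ★ **THE RIGHT-FORM STEP MEMBERS `tDd μ ε ∕ tDd1 μ ε` OUT OF A CLASS-LOCALISED INPUT NORM, FROM THE (3.44)-TYPE MEMBER D\*_U G₀ ∇\*_{U,μ} ALONE** —
dag-n06-l's `B9Thm312WholeRightStepFrom3131C.tDd_of_letters3131RC` VERBATIM except that the record hypothesis
`hdiv : Thm33G0DivR 𝔬 Dds R₀ H₀ _ bHX bHW BiD BdD δ₀ δ₃ U` is replaced by its first field `hdivDs` (the original proof reads `hdiv.h44Ds μ ε hε` and nothing
else of the record): Δ′_πG₀∇\*_{U,μ} and (Δ′_π + Δ⁽²⁾_π)G₀∇\*_{U,μ} map `bHX ε` into 𝔠⁽¹⁾ with `(m·B₀L₀ + B_iD(ε))·t·c·e^{−(ρ−αδ)d}` resp. twice that.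
[cite: Balaban1985BackgroundPropagators, Thm 3.12 p.423 + (3.130)–(3.131) pp.421–422 + (3.137)–(3.138) p.423 + (3.42)–(3.44) pp.397–398 + p.398; Balaban1984PropagatorsII, (2.52) p.232 + (2.54) p.233 + Lemma 2.1 (2.60)–(2.61) p.234] -/
theorem tDd_of_letters3131RC_ofDs (hG : GeoOK g) {d : ℕ} {δ α L₀ : ℝ} (hF : Facts347 g R₀ H₀ d δ α L₀) {𝔬 : Ops g B X Y Z W}
    {Dds : B.Cfg → P → Module.End ℝ (X → ℝ)} {bHX : ℝ → BlockNorm (toB6 g R₀ H₀) (X → ℝ)}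
    {Ta Ta₂ : B.Cfg → Module.End ℝ (X → ℝ)}
    {Tb Tb₂ : B.Cfg → (W → ℝ) →ₗ[ℝ] (X → ℝ)} {U : B.Cfg} {B₀ t δ₀ δT ρ σ c : ℝ} {BiD : ℝ → ℝ}
    (hrow : RowSum (toB6 g R₀ H₀) σ c) (hB₀ : 0 ≤ B₀) (ht : 0 ≤ t) (hBiD : ∀ ε : ℝ, 0 < ε → 0 ≤ BiD ε)
    (hαρ : α * δ ≤ ρ) (hαδ : 0 ≤ α * δ) (hρT : ρ ≤ δT) (hρ₀ : ρ + σ ≤ δ₀)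
    (he2d : ∀ μ : P, HasMajorantHom (g := toB6 g R₀ H₀) 𝔬.blk 𝔬.blk (𝔬.G0 U ∘ₗ Dds U μ)
      (fun (a b : g.Site) => B₀ * g.len a * Real.exp (-(δ₀ * g.dist a b))))
    (Rel : g.Site → g.Site → Prop) [DecidableRel Rel] {m : ℝ} (hm : 0 ≤ m)
    (hmult : ∀ y' : g.Site, ((Finset.univ.filter (fun y'' => Rel y'' y')).card : ℝ) ≤ m)
    (hRel : ∀ a b b' : g.Site, Rel b' b → g.dist a b' = g.dist a b)
    (hvanishX : ∀ ε : ℝ, 0 < ε → ∀ (y' : g.Site) (μ : X → ℝ), (bHX ε).IsLoc y' μ → ∀ y'' : g.Site, ¬ Rel y'' y' →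
      (BlockNorm.ofBlocks (toB6 g R₀ H₀) 𝔬.blk).cut y'' μ = 0)
    (hleX : ∀ ε : ℝ, 0 < ε → ∀ (y' : g.Site) (μ : X → ℝ), (bHX ε).IsLoc y' μ → ∀ y'' : g.Site, Rel y'' y' →
      (BlockNorm.ofBlocks (toB6 g R₀ H₀) 𝔬.blk).loc y'' ((BlockNorm.ofBlocks (toB6 g R₀ H₀) 𝔬.blk).cut y'' μ) ≤ (bHX ε).loc y' μ)
    (hdivDs : ∀ (μ : P) (ε : ℝ), 0 < ε → HasMaj (bHX ε) (cNormR R₀ H₀ 𝔬.blkW hG.lenle 0) (𝔬.Dvstar U ∘ₗ (𝔬.G0 U ∘ₗ Dds U μ))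
      (fun a b => BiD ε * Real.exp (-(δ₀ * g.dist a b))))
    (hR : Letters3131R 𝔬 Ta Ta₂ Tb Tb₂ R₀ H₀ hG.lenle t δT U)
    (μ : P) (ε : ℝ) (hε : 0 < ε) :
    HasMaj (bHX ε) (cNormR R₀ H₀ 𝔬.blk hG.lenle 1) (𝔬.Tpi U ∘ₗ (𝔬.G0 U ∘ₗ Dds U μ))
        (fun a b => (m * B₀ * L₀ + BiD ε) * t * c * Real.exp (-((ρ - α * δ) * g.dist a b))) ∧
      HasMaj (bHX ε) (cNormR R₀ H₀ 𝔬.blk hG.lenle 1) ((𝔬.Tpi U + 𝔬.T2 U) ∘ₗ (𝔬.G0 U ∘ₗ Dds U μ))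
        (fun a b => 2 * ((m * B₀ * L₀ + BiD ε) * t * c) * Real.exp (-((ρ - α * δ) * g.dist a b))) := by
  -- G₀∇\*_μ : 𝔠⁽⁰⁾ → 𝔠^{(−1)}, then out of the dominating input class
  have hG1 : HasMaj (cNormR R₀ H₀ 𝔬.blk hG.lenle 0) (cNormR R₀ H₀ 𝔬.blk hG.lenle (-1)) (𝔬.G0 U ∘ₗ Dds U μ)
      (fun a b => B₀ * Real.exp (-(δ₀ * g.dist a b))) :=
    hasMaj_cNormR_of_hasMajorantHom hG (C := fun a b => B₀ * Real.exp (-(δ₀ * g.dist a b)))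
      (fun a b => mul_nonneg hB₀ (Real.exp_nonneg _)) 1 0
      (hasMajorantHom_mono (g := toB6 g R₀ H₀) 𝔬.blk 𝔬.blk (he2d μ) fun a b =>
        le_of_eq (by simp only [Real.rpow_zero, Real.rpow_one, mul_one]; ring))
  -- out of the CLASS-localised input norm by dag-n06-d's class-multiplicity transfer (repair «R2-loc»): the constant picks up `m`
  have hGF : HasMaj (bHX ε) (cNormR R₀ H₀ 𝔬.blk hG.lenle (-1)) (𝔬.G0 U ∘ₗ Dds U μ)
      (fun a b => m * B₀ * Real.exp (-(δ₀ * g.dist a b))) := by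
    refine (hasMaj_of_dom_classes_eq Rel (hvanishX ε hε) (hleX ε hε) (fun a b => mul_nonneg hB₀ (Real.exp_nonneg _))
      (fun a b b' hb => by rw [hRel a b b' hb]) hmult (hasMaj_of_in_zero hG1)).mono fun a b => le_of_eq ?_
    ring
  have hmB₀ : 0 ≤ m * B₀ := mul_nonneg hm hB₀
  have hρa : ρ - α * δ + σ ≤ δ₀ := by linarith
  have hA := rightStep_of_splitR hG hF hrow hmB₀ (hBiD ε hε) ht hαρ hαδ hρT hρa hρa hR.splitR hGF (hdivDs μ ε hε) hR.ta hR.tb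
  have hB := rightStep_of_splitR hG hF hrow hmB₀ (hBiD ε hε) ht hαρ hαδ hρT hρa hρa hR.splitR₂ hGF (hdivDs μ ε hε) hR.ta₂
    hR.tb₂
  refine ⟨hA, ((hA.add hB).congr fun ν => ?_).mono fun a b => le_of_eq ?_⟩
  · simp only [LinearMap.add_apply, LinearMap.comp_apply]
  · ring

omit [Fintype Y] [Fintype P] in
/-- ★★ **THE β∕ε-INDEXED STEP SCHEMA OF ROWS 20–21 FROM THEOREM 3.3 FOR G₀ AND THE LETTERS, INPUT NORM LOCALISED ON CARRIER CLASSES, WITH THE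
(3.44)-TYPE HYPOTHESIS WEAKENED TO THE FIELD THE ENGINE READS** — dag-n06-l's `B9Thm312WholeDirBC.stepDirB_of_letters3131LRCZ` VERBATIM (statement, constants,
rates, conclusion `StepDirB 𝔬 𝔭 Dd Dds R₀ H₀ bHX hlen θD θH θI δK U`) except that the record hypothesis `hdiv : Thm33G0DivR 𝔬 Dds R₀ H₀ _ bHX bHW BiD BdD δ₀ δ₃ U`
(BOTH (3.44)-type members of Theorem 3.3 for G₀ with D\*_U on the left) is replaced by its FIRST field alone,
`hdivDs : ∀ μ ε, 0 < ε → HasMaj (bHX ε) (cNormR R₀ H₀ 𝔬.blkW _ 0) (D\*_U G₀ ∇\*_{U,μ}) (B_iD(ε)·e^{−δ₀d})` — the only field the proof reads (through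
`tDd_of_letters3131RC_ofDs`); the implicit letters `bHW ∕ BdD` of the unread second field `h44DsDv` (D\*_U G₀ D_U out of the scalar input class) disappear,
`δ₃` stays (it is the rate of `Letters313HZ ∕ Letters313DMZ ∕ Thm33G0DirX` and of `hρ₃`).  The original engine follows as the one-line corollary
`stepDirB_of_letters3131LRCZ_ofDs … (fun μ ε hε => hdiv.h44Ds μ ε hε) …` (not restated here — it is the landed declaration).
[cite: Balaban1985BackgroundPropagators, Thm 3.12 p.423 + (3.130)–(3.131) pp.421–422 + (3.137)–(3.138) p.423 + Thm 3.3 p.399 + (3.42)–(3.45) pp.397–398 + p.398 (remarks after (3.47)); Balaban1984PropagatorsII, (2.26) p.228 + (2.52) p.232 + (2.54) p.233 + Lemma 2.1 (2.60)–(2.61) p.234] -/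
theorem stepDirB_of_letters3131LRCZ_ofDs (hG : GeoOK g) {𝔬 : Ops g B X Y Z W} {𝔭 : HolderProbes g B X Y PX PY}
    {Dd Dds : B.Cfg → P → Module.End ℝ (X → ℝ)} {bHX : ℝ → BlockNorm (toB6 g R₀ H₀) (X → ℝ)}
    {bH : BlockNorm (toB6 g R₀ H₀) (W → ℝ)}
    {Ta Ta₂ : B.Cfg → Module.End ℝ (X → ℝ)} {Tb Tb₂ : B.Cfg → (X → ℝ) →ₗ[ℝ] (W → ℝ)}
    {Ta' Ta₂' : B.Cfg → Module.End ℝ (X → ℝ)} {Tb' Tb₂' : B.Cfg → (W → ℝ) →ₗ[ℝ] (X → ℝ)}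
    {U : B.Cfg} {d : ℕ} {δ α L₀ : ℝ} (hF : Facts347 g R₀ H₀ d δ α L₀)
    {B₀ B₃ t δ₀ δ₃ δT ρ σ c θD δK : ℝ} {θH θI Bh Bi : ℝ → ℝ} {Bi2 : ℝ → ℝ → ℝ} {BhD Bx Bq Bx0 BdX BiD : ℝ → ℝ}
    (hrow : RowSum (toB6 g R₀ H₀) σ c) (hc : 0 ≤ c) (hB₀ : 0 ≤ B₀) (hB₃ : 0 ≤ B₃) (ht : 0 ≤ t)
    (hBh : ∀ β : ℝ, 0 ≤ β → β < 1 → 0 ≤ Bh β) (hBhD : ∀ β : ℝ, 0 ≤ β → β < 1 → 0 ≤ BhD β)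
    (hBx : ∀ β : ℝ, 0 ≤ β → β < 1 → 0 ≤ Bx β) (hBx0 : ∀ β : ℝ, 0 ≤ β → β < 1 → 0 ≤ Bx0 β)
    (hBdX : ∀ β : ℝ, 0 ≤ β → β < 1 → 0 ≤ BdX β) (hBiD : ∀ ε : ℝ, 0 < ε → 0 ≤ BiD ε)
    (Rel : g.Site → g.Site → Prop) [DecidableRel Rel] {m : ℝ} (hm : 0 ≤ m)
    (hmult : ∀ y' : g.Site, ((Finset.univ.filter (fun y'' => Rel y'' y')).card : ℝ) ≤ m)
    (hRel : ∀ a b b' : g.Site, Rel b' b → g.dist a b' = g.dist a b)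
    (hρT : ρ ≤ δT) (hρ₀ : ρ + σ ≤ δ₀) (hρ₃ : ρ + σ ≤ δ₃) (hαδ : 0 ≤ α * δ) (hδK0 : 0 ≤ δK) (hδK : δK + α * δ ≤ ρ)
    (hθD : 2 * ((B₀ + bH.κ * B₃) * t * c) ≤ θD)
    (hθH1 : ∀ β : ℝ, 0 ≤ β → β < 1 → 2 * ((Bh β + bH.κ * BhD β) * t * c) ≤ θH β)
    (hθH2 : ∀ β : ℝ, 0 ≤ β → β < 1 → 2 * ((Bh β + bH.κ * BdX β) * t * c) ≤ θH β)
    (hθH3 : ∀ β : ℝ, 0 ≤ β → β < 1 → 2 * ((Bx0 β + Bx β) * t * c * L₀) ≤ θH β)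
    (hθI : ∀ ε : ℝ, 0 < ε → 2 * ((m * B₀ * L₀ + BiD ε) * t * c) ≤ θI ε)
    (h33 : Thm33G0Dir 𝔬 𝔭 Dd Dds R₀ H₀ bHX B₀ Bh Bi Bi2 δ₀ U) (h33R : Thm33G0DirR 𝔬 Dds R₀ H₀ B₀ δ₀ U)
    {wZ : g.Site → ℝ} {hwZ : ∀ y, 0 < wZ y} (hLH3 : Letters313HZ 𝔬 𝔭 R₀ H₀ hG wZ hwZ bH BhD Bx δ₃ U)
    (hDM : Letters313DMZ 𝔬 𝔭 Dd R₀ H₀ hG wZ hwZ B₃ Bq δ₃ bH U) (hX : Thm33G0DirX 𝔬 𝔭 Dd R₀ H₀ hG.lenle bH Bx0 BdX δ₀ δ₃ U)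
    (hdivDs : ∀ (μ : P) (ε : ℝ), 0 < ε → HasMaj (bHX ε) (cNormR R₀ H₀ 𝔬.blkW hG.lenle 0) (𝔬.Dvstar U ∘ₗ (𝔬.G0 U ∘ₗ Dds U μ))
      (fun a b => BiD ε * Real.exp (-(δ₀ * g.dist a b))))
    (hvanishX : ∀ ε : ℝ, 0 < ε → ∀ (y' : g.Site) (μ : X → ℝ), (bHX ε).IsLoc y' μ → ∀ y'' : g.Site, ¬ Rel y'' y' →
      (BlockNorm.ofBlocks (toB6 g R₀ H₀) 𝔬.blk).cut y'' μ = 0)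
    (hleX : ∀ ε : ℝ, 0 < ε → ∀ (y' : g.Site) (μ : X → ℝ), (bHX ε).IsLoc y' μ → ∀ y'' : g.Site, Rel y'' y' →
      (BlockNorm.ofBlocks (toB6 g R₀ H₀) 𝔬.blk).loc y'' ((BlockNorm.ofBlocks (toB6 g R₀ H₀) 𝔬.blk).cut y'' μ) ≤ (bHX ε).loc y' μ)
    (hL : Letters3131 𝔬 Ta Ta₂ Tb Tb₂ R₀ H₀ hG.lenle t δT U) (hLH : Letters3131H 𝔬 Tb Tb₂ R₀ H₀ hG.lenle bH t δT U)
    (hR : Letters3131R 𝔬 Ta' Ta₂' Tb' Tb₂' R₀ H₀ hG.lenle t δT U) :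
    StepDirB 𝔬 𝔭 Dd Dds R₀ H₀ bHX hG.lenle θD θH θI δK U := by
  have hρ : 0 ≤ ρ := by linarith
  have hαρ : α * δ ≤ ρ := by linarith
  have hδKρ : δK ≤ ρ := by linarith
  have hδKρ' : δK ≤ ρ - α * δ := by linarith
  have hL₀ : 0 ≤ L₀ := le_trans (le_trans zero_le_one hF.one_le_L) hF.L_le
  -- the probe members E = Φ^Y_β∇_U, Φ^X_β∇_{U,ν} at β (pointwise θ_H(β))
  have probe2 : ∀ {F : Type} [AddCommGroup F] [Module ℝ F] {bout : BlockNorm (toB6 g R₀ H₀) F} {EG : (X → ℝ) →ₗ[ℝ] F} {a aD θ : ℝ},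
      0 ≤ a → 0 ≤ aD → 2 * ((a + bH.κ * aD) * t * c) ≤ θ →
      HasMaj (cNormR R₀ H₀ 𝔬.blk hG.lenle 0) bout EG (fun a' b => a * Real.exp (-(δ₀ * g.dist a' b))) →
      HasMaj bH bout (EG ∘ₗ 𝔬.Dv U) (fun a' b => aD * Real.exp (-(δ₃ * g.dist a' b))) →
      HasMaj (cNormR R₀ H₀ 𝔬.blk hG.lenle (-2)) bout (EG ∘ₗ 𝔬.Tpi U) (fun a' b => θ * Real.exp (-(δK * g.dist a' b))) ∧
        HasMaj (cNormR R₀ H₀ 𝔬.blk hG.lenle (-2)) bout (EG ∘ₗ (𝔬.Tpi U + 𝔬.T2 U))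
          (fun a' b => θ * Real.exp (-(δK * g.dist a' b))) := by
    intro F _ _ bout EG a aD θ ha haD hθ hE hED
    have hA := probeStep_of_split hG hrow ha haD ht hρ hρT hρ₀ hρ₃ hL.split hE hED hL.ta hLH.tbH
    have hB := probeStep_of_split hG hrow ha haD ht hρ hρT hρ₀ hρ₃ hL.split₂ hE hED hL.ta₂ hLH.tb₂H
    have hK : 0 ≤ (a + bH.κ * aD) * t * c := mul_nonneg (mul_nonneg (add_nonneg ha (mul_nonneg bH.κ_nonneg haD)) ht) hc
    have hc1 : (a + bH.κ * aD) * t * c ≤ θ := by linarith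
    refine ⟨hA.mono fun a' b => kernel_le_z hK hc1 hδKρ (hG.dnn a' b), ((hA.add hB).congr fun μ => ?_).mono fun a' b => ?_⟩
    · simp only [LinearMap.add_apply, LinearMap.comp_apply, map_add]
    · calc (a + bH.κ * aD) * t * c * Real.exp (-(ρ * g.dist a' b)) + (a + bH.κ * aD) * t * c * Real.exp (-(ρ * g.dist a' b))
          = 2 * ((a + bH.κ * aD) * t * c) * Real.exp (-(ρ * g.dist a' b)) := by ring
        _ ≤ θ * Real.exp (-(δK * g.dist a' b)) := kernel_le_z (mul_nonneg (by norm_num) hK) hθ hδKρ (hG.dnn a' b)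
  -- the Φ^X_β member of the step itself at β
  have probeX2 : ∀ β : ℝ, 0 ≤ β → β < 1 →
      HasMaj (cNormR R₀ H₀ 𝔬.blk hG.lenle (-1)) (cNormR R₀ H₀ 𝔭.blkPX hG.lenle (β - 1)) ((𝔭.ΦX U β ∘ₗ 𝔬.G0 U) ∘ₗ 𝔬.Tpi U)
          (fun a' b => θH β * Real.exp (-(δK * g.dist a' b))) ∧
        HasMaj (cNormR R₀ H₀ 𝔬.blk hG.lenle (-1)) (cNormR R₀ H₀ 𝔭.blkPX hG.lenle (β - 1))
          ((𝔭.ΦX U β ∘ₗ 𝔬.G0 U) ∘ₗ (𝔬.Tpi U + 𝔬.T2 U)) (fun a' b => θH β * Real.exp (-(δK * g.dist a' b))) := by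
    intro β hβ0 hβ1
    have hA := probeStepX_of_split hG hF hrow hc (hBx0 β hβ0 hβ1) (hBx β hβ0 hβ1) ht hαρ hαδ hρT hρ₀ hρ₃ hL.split
      (hX.pX0 β hβ0 hβ1) (hLH3.pXDv β hβ0 hβ1) hL.ta hL.tb
    have hB := probeStepX_of_split hG hF hrow hc (hBx0 β hβ0 hβ1) (hBx β hβ0 hβ1) ht hαρ hαδ hρT hρ₀ hρ₃ hL.split₂
      (hX.pX0 β hβ0 hβ1) (hLH3.pXDv β hβ0 hβ1) hL.ta₂ hL.tb₂
    have hK : 0 ≤ (Bx0 β + Bx β) * t * c * L₀ :=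
      mul_nonneg (mul_nonneg (mul_nonneg (add_nonneg (hBx0 β hβ0 hβ1) (hBx β hβ0 hβ1)) ht) hc) hL₀
    have hc1 : (Bx0 β + Bx β) * t * c * L₀ ≤ θH β := by linarith [hθH3 β hβ0 hβ1]
    refine ⟨hA.mono fun a' b => kernel_le_z hK hc1 hδKρ' (hG.dnn a' b), ((hA.add hB).congr fun μ => ?_).mono fun a' b => ?_⟩
    · simp only [LinearMap.add_apply, LinearMap.comp_apply, map_add]
    · calc (Bx0 β + Bx β) * t * c * L₀ * Real.exp (-((ρ - α * δ) * g.dist a' b)) +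
            (Bx0 β + Bx β) * t * c * L₀ * Real.exp (-((ρ - α * δ) * g.dist a' b))
          = 2 * ((Bx0 β + Bx β) * t * c * L₀) * Real.exp (-((ρ - α * δ) * g.dist a' b)) := by ring
        _ ≤ θH β * Real.exp (-(δK * g.dist a' b)) := kernel_le_z (mul_nonneg (by norm_num) hK) (hθH3 β hβ0 hβ1) hδKρ' (hG.dnn a' b)
  -- the right-form members at ε (pointwise θ_I(ε))
  have hright := fun (μ : P) (ε : ℝ) (hε : 0 < ε) =>
    tDd_of_letters3131RC_ofDs hG hF hrow hB₀ ht hBiD hαρ hαδ hρT hρ₀ h33R.e2d Rel hm hmult hRel hvanishX hleX hdivDs hR μ ε hε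
  have hKI : ∀ ε : ℝ, 0 < ε → 0 ≤ (m * B₀ * L₀ + BiD ε) * t * c := fun ε hε =>
    mul_nonneg (mul_nonneg (add_nonneg (mul_nonneg (mul_nonneg hm hB₀) hL₀) (hBiD ε hε)) ht) hc
  refine
    { pY := fun β hβ0 hβ1 => (probe2 (hBh β hβ0 hβ1) (hBhD β hβ0 hβ1) (hθH1 β hβ0 hβ1)
        (hasMaj_probe_cNormR_of_hom hG (hBh β hβ0 hβ1) (h33.h43L β hβ0 hβ1)) (hLH3.pYDH β hβ0 hβ1)).1
      pY1 := fun β hβ0 hβ1 => (probe2 (hBh β hβ0 hβ1) (hBhD β hβ0 hβ1) (hθH1 β hβ0 hβ1)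
        (hasMaj_probe_cNormR_of_hom hG (hBh β hβ0 hβ1) (h33.h43L β hβ0 hβ1)) (hLH3.pYDH β hβ0 hβ1)).2
      pX := fun β hβ0 hβ1 => (probeX2 β hβ0 hβ1).1
      pX1 := fun β hβ0 hβ1 => (probeX2 β hβ0 hβ1).2
      sDd := fun ν => (stepDd_of_letters3131 hG hrow hc hB₀ hB₃ ht hρ hρT hρ₀ hρ₃ hθD hδKρ h33.e1d hDM.dgDHd hL hLH ν).1
      sDd1 := fun ν => (stepDd_of_letters3131 hG hrow hc hB₀ hB₃ ht hρ hρT hρ₀ hρ₃ hθD hδKρ h33.e1d hDM.dgDHd hL hLH ν).2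
      pXd := fun ν β hβ0 hβ1 => (probe2 (hBh β hβ0 hβ1) (hBdX β hβ0 hβ1) (hθH2 β hβ0 hβ1)
        (hasMaj_probe_cNormR_of_hom hG (hBh β hβ0 hβ1) (h33.h43d ν β hβ0 hβ1)) (hX.pXdDH ν β hβ0 hβ1)).1
      pXd1 := fun ν β hβ0 hβ1 => (probe2 (hBh β hβ0 hβ1) (hBdX β hβ0 hβ1) (hθH2 β hβ0 hβ1)
        (hasMaj_probe_cNormR_of_hom hG (hBh β hβ0 hβ1) (h33.h43d ν β hβ0 hβ1)) (hX.pXdDH ν β hβ0 hβ1)).2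
      tDd := fun μ ε hε => by
        have hc1 : (m * B₀ * L₀ + BiD ε) * t * c ≤ θI ε := by linarith [hθI ε hε, hKI ε hε]
        exact (hright μ ε hε).1.mono fun a b => kernel_le_z (hKI ε hε) hc1 hδKρ' (hG.dnn a b)
      tDd1 := fun μ ε hε =>
        (hright μ ε hε).2.mono fun a b => kernel_le_z (mul_nonneg (by norm_num) (hKI ε hε)) (hθI ε hε) hδKρ' (hG.dnn a b) }

end OneMember

end

end Literature.MathematicalPhysics.QuantumFieldTheory.Balaban1983to89.B9Thm312WholeDirBCDs
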